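import Summits.QuantumFields.BalabanUV.T4Continuum.Support.NE7FlatAverageCurlCommutation
import Summits.QuantumFields.BalabanUV.T4Continuum.Support.NE3TangentFlatStructure
import HarnessLib

/-!
# NE7LevelQFlatChain — THE MULTI-LEVEL CONSTRAINT DIFFERENTIAL AT THE FLAT BACKGROUND IS THE ITERATED CONTOUR AVERAGE:
# `chartDir (levelQ' L N j 1 X) = (Tcoarse L)^[j+1] (chartDir X)`, equivalently `levelQ' L N j 1 X = skewPR N (resDir N ((Tcoarse L)^[j+1] X̃))` (every `d`, `U(n)`, `j`, `N`)

Lineage `b2b-balaban-t4-ne7-p1` (CRUX PROVER NE7 #1 = OWNER of BINDER row NE7), generation 116.  A dictionary lemma used twice downstream: by the abelian-sector line (ROAD-G116 §7 (G-ab):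
the curved constraint map `levelQ L N j U ∘ chart_U` agrees near `0` with this continuous linear map, so its second derivative vanishes) and by any right-inverse construction
(cf. row NE7b's ✓ `NE7SmoothRightInverseLevelQ.coe_levelQ'_flatCfg_resDir`, the `resDir` reading of the same fact).  From ✓ `NE7FlatAverageCurlCommutation.levelQ'_succ_flatCfg` ∕
`coe_levelQ'_zero_flatCfg` ∕ `chartDir_fderiv_coord_flatCfg` and the definition `Tcoarse L c z κ = Tside L c (L•z) κ` of ✓ `SmoothRefineNeutral`.
WHAT ([folklore]; 0 def, 0 sorry): **`levelQ'_chain`**, `Tcoarse_add'`, `iterate_Tcoarse_add` (the exact-cochain twin `iterate_Tcoarse_dPot` is ✓ `NE7FramePotL1`'s),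
`isSkewDir_iterate_Tcoarse`, `resDir_chartDir_id`, **`levelQ'_flatCfg_eq_skewPR_resDir`**.
HONEST FRAMING: flat background; OUR linearised average (B11 (8) chart); kinematics only; nothing of Bałaban's asserted; NOT NE7 as a spine node; spine 0∕9; NOT infinite volume,
NOT mass gap, NOT BetaPertH, NOT Clay.
-/

set_option autoImplicit false

open scoped BigOperators Matrix Matrix.Norms.L2Operator Topology
open Finset

namespace Summit.QuantumFields.BalabanUV.T4Continuum.NE7LevelQFlatChain

open Literature.MathematicalPhysics.QuantumFieldTheory.Balaban1983to89
open B7Prop1Explicit B7Prop2Explicit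
open T4AveragingDeficitWall (IsSkewDir)
open AveragingDeficitTorusChart (TDir chartDir resDir redN_boxVec)
open AveragingDeficitChartCalculus (coord)
open AveragingDeficitTwoLevelPrep (skewSub skewPR skewPF_of_mem)
open AveragingDeficitMultiLevelPrep (tower levelQ' tower_ne_zero)
open MinimalActionWitness (flatCfg)
open SmoothRefineNeutral (Tcoarse)
open NE3TangentNoGoWords (dPot)
open NE3TangentFlatStructure (Tcoarse_dPot)
open NE3TangentFlatPush (Tside_add)
open NE7FlatAverageCurlCommutation (chartDir_fderiv_coord_flatCfg Tside_mem_skewAdjoint isSkewDir_chartDir_id fderiv_coord_flatCfg_mem_skewSub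
  coe_levelQ'_zero_flatCfg levelQ'_succ_flatCfg)

noncomputable section

variable {d : ℕ} {n : Type} [Fintype n] [DecidableEq n]

/-! ## §1 The multi-level constraint differential at the flat background is the iterated contour average -/

/-- **`chartDir (levelQ' L N j 1 X) = (Tcoarse L)^[j+1] (chartDir X)`** for every skew `X` on the finest torus (`levelQ'_succ_flatCfg` iterated, the one-step differential being
`Tside` read on `ℤ^d`, ✓ `chartDir_fderiv_coord_flatCfg`). [folklore] -/
theorem levelQ'_chain {L N : ℕ} [NeZero L] [NeZero N] :
    ∀ (j : ℕ) {X : TDir d n (L * tower L N j)}, X ∈ skewSub d n (L * tower L N j) →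
      chartDir (ContinuousLinearMap.id ℝ (Matrix n n ℂ)) N ((levelQ' L N j (flatCfg : Site d → Fin d → (Matrix n n ℂ)ˣ) X : ↥(skewSub d n N)) : TDir d n N)
        = (Tcoarse L)^[j + 1] (chartDir (ContinuousLinearMap.id ℝ (Matrix n n ℂ)) (L * tower L N j) X)
  | 0, X, hX => by
      haveI : NeZero (L * N) := ⟨Nat.mul_ne_zero (NeZero.ne L) (NeZero.ne N)⟩
      have h0 := coe_levelQ'_zero_flatCfg (d := d) (n := n) (L := L) (N := N) (X := X) hX
      funext x κ
      rw [h0, zero_add, Function.iterate_one, chartDir_fderiv_coord_flatCfg]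
      rfl
  | j + 1, X, hX => by
      haveI : NeZero (L * tower L N j) := ⟨Nat.mul_ne_zero (NeZero.ne L) (tower_ne_zero L N j)⟩
      rw [levelQ'_succ_flatCfg, levelQ'_chain j (fderiv_coord_flatCfg_mem_skewSub hX)]
      conv_rhs => rw [Function.iterate_succ_apply]
      congr 1
      funext x κ
      rw [chartDir_fderiv_coord_flatCfg]
      rfl

/-- `Tcoarse` is additive. [folklore] -/
theorem Tcoarse_add' (L : ℕ) (A B : Site d → Fin d → Matrix n n ℂ) :
    Tcoarse L (fun y μ => A y μ + B y μ) = fun z κ => Tcoarse L A z κ + Tcoarse L B z κ := by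
  funext z κ
  exact Tside_add L A B ((L : ℤ) • z) κ

/-- The iterated contour average is additive. [folklore] -/
theorem iterate_Tcoarse_add (L : ℕ) :
    ∀ (k : ℕ) (A B : Site d → Fin d → Matrix n n ℂ), (Tcoarse L)^[k] (fun y μ => A y μ + B y μ) = fun z κ => (Tcoarse L)^[k] A z κ + (Tcoarse L)^[k] B z κ
  | 0, _, _ => rfl
  | k + 1, A, B => by
      rw [Function.iterate_succ_apply, Function.iterate_succ_apply, Function.iterate_succ_apply, Tcoarse_add', iterate_Tcoarse_add L k]

/-- The iterated contour average of a skew direction field is skew. [folklore] -/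
theorem isSkewDir_iterate_Tcoarse (L : ℕ) : ∀ (k : ℕ) {Y : Site d → Fin d → Matrix n n ℂ}, IsSkewDir Y → IsSkewDir ((Tcoarse L)^[k] Y)
  | 0, _, hY => hY
  | k + 1, _, hY => by
      rw [Function.iterate_succ_apply']
      exact fun z κ => Tside_mem_skewAdjoint L (isSkewDir_iterate_Tcoarse L k hY) _ κ

omit [Fintype n] [DecidableEq n] in
/-- `chartDir id` is injective on torus fields (restriction recovers the field). [folklore] -/
theorem resDir_chartDir_id (N : ℕ) [NeZero N] (ψ : TDir d n N) : resDir N (chartDir (ContinuousLinearMap.id ℝ (Matrix n n ℂ)) N ψ) = ψ := by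
  funext r κ
  simp only [resDir, chartDir, ContinuousLinearMap.coe_id', id, redN_boxVec]


/-- **THE FLAT MULTI-LEVEL CONSTRAINT DIFFERENTIAL AS A FORMULA**: for skew `X`, `levelQ' L N j 1 X = skewPR N (resDir N ((Tcoarse L)^[j+1] (chartDir X)))`. [folklore] -/
theorem levelQ'_flatCfg_eq_skewPR_resDir {L N : ℕ} [NeZero L] [NeZero N] (j : ℕ) {X : TDir d n (L * tower L N j)} (hX : X ∈ skewSub d n (L * tower L N j)) :
    levelQ' L N j (flatCfg : Site d → Fin d → (Matrix n n ℂ)ˣ) X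
      = skewPR N (resDir N ((Tcoarse L)^[j + 1] (chartDir (ContinuousLinearMap.id ℝ (Matrix n n ℂ)) (L * tower L N j) X))) := by
  apply Subtype.ext
  have h := levelQ'_chain (n := n) j hX
  have hskew : resDir N ((Tcoarse L)^[j + 1] (chartDir (ContinuousLinearMap.id ℝ (Matrix n n ℂ)) (L * tower L N j) X)) ∈ skewSub d n N :=
    fun r κ => isSkewDir_iterate_Tcoarse L (j + 1) (isSkewDir_chartDir_id hX) _ κ
  have h1 : ((levelQ' L N j (flatCfg : Site d → Fin d → (Matrix n n ℂ)ˣ) X : ↥(skewSub d n N)) : TDir d n N)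
      = resDir N ((Tcoarse L)^[j + 1] (chartDir (ContinuousLinearMap.id ℝ (Matrix n n ℂ)) (L * tower L N j) X)) := by
    rw [← h, resDir_chartDir_id]
  rw [h1]
  show _ = AveragingDeficitTwoLevelPrep.skewPF N _
  rw [skewPF_of_mem hskew]

end

end Summit.QuantumFields.BalabanUV.T4Continuum.NE7LevelQFlatChain
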